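import Summits.Langlands.Langlands.Theses.IrreducibilityBySelfDuality
import Summits.Langlands.Langlands.Theorems.IrreducibilityBySelfDualityRegularTwistFromHalfIntegralShadow
import Summits.Langlands.Langlands.Theorems.IrreducibilityBySelfDualityRegularTwistCMDihedralVacuity
import Summits.Langlands.Langlands.Theorems.IrreducibilityBySelfDualityRegularTwistCMCentralCharacterDatum
import Literature.NumberTheory.Automorphic.ClozelPurityProofs
import HarnessLib

/-!
# `RegularTwistFromHalfIntegral` (route `IrreducibilityBySelfDuality`, item stmt-Langlands-14726):
# the lever `HalfIntegralTwistCM` feeds the crux `RegularTwistCM` — proved MODULO the archimedean inputs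

The glue item is `HalfIntegralTwistCM → RegularTwistCM`: for `K` CM, `π` regular algebraic cuspidal on
`GL₃(𝔸_K)`, `σ₀` cuspidal on `GL₂(𝔸_K)` and a `GL(1)` datum `ν` with `t_{π,v} = d_v · Ad(t_{σ₀,v})`
a.e., SOME `GL(1)`-twist `σ = σ₀ ⊗ χ` is regular algebraic — granted the half-integral re-twisting
lemma over CM fields (`HalfIntegralTwistCM`, route item stmt-Langlands-14036, taken BY NAME as the
antecedent).

This file is the composition of the r3 lead's kernel-checked skeleton
`Cruxes/RegularTwistCM/Lines/petersson-hermitian-purity.lean` (`RegularTwistCM_of_stubs`, lead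
prover-line-stmt-Langlands-14069-0), with

* the three LANDED stubs imported by name (`stub_dihedralVacuity`, `stub_centralCharacterDatum`,
  `stub_twistRealisation`, namespace `Summit.Langlands.Langlands.Theorems.RegularTwistCM`);
* the parity input (iii) of `HalfIntegralTwistCM` read off CLOZEL'S PURITY LEMMA, now a theorem of the
  tree (`CuspidalAutomorphicRepData.purity_of_isCAlgebraic`, `ClozelPurityProofs`: `{a at ῑ} = {w - a}`
  for the C-algebraic `π`), in place of the skeleton's unitary mirror (same arithmetic,
  `parity_of_purity3`);
* the adjoint archimedean shadow (stub 1a: `π_w ≅ Ad(σ₀,w) ⊗ ν_w` on Harish-Chandra parameters)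
  PROVED MODULO three named facts of the tree — Gelbart–Jacquet 1978 Thm (9.3) with its archimedean
  clause (`GelbartJacquet_adjoint_lift_archimedean`) and strong multiplicity one with archimedean
  components, which the tree reduces (`CuspidalAutomorphicRepData.hasArchParameter_eq_of_isNearlyEquivalent`)
  to the Borel–Jacquet dictionary `hasSatakeParamAt_iff_L2` and `strong_multiplicity_one_gl_sphericalLevel 3`
  (Jacquet–Shalika 1981 II, Thm. 4.4) — theorem `adjointArchShadowNonDihedral_of_GJ`;
* the descent infinity type (stub 2) kept as the tree's named fact
  `AutomorphicRepData.exists_hasInfinityType` on cuspidal `GL₂` data (Clozel 1990 §3.3: the INTEGRAL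
  PAIRING `s_i ι - s_i ῑ ∈ ℤ`, local archimedean representation theory of `GL₂(ℂ)`).

Main results:

* `RegularTwistFromHalfIntegral_of_inputs` — the route decl from the adjoint shadow and the descent
  infinity type (both stated verbatim as the skeleton's stubs 1a / 2), everything else proved;
* `RegularTwistFromHalfIntegral_of` — the route decl from the four named facts above (CONDITIONAL
  result: the item closes the day `GelbartJacquet_adjoint_lift_archimedean`, `hasSatakeParamAt_iff_L2`,
  `strong_multiplicity_one_gl_sphericalLevel 3 K` and `exists_hasInfinityType` (rank 2) are discharged).

Uses of the crux's hypotheses (as in the skeleton): `IsCMField` only through `HalfIntegralTwistCM`;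
`π.1.IsRegularAlgebraic` for integrality (`s₁ ι - s₂ ι ∈ ℤ`, `q ι ∈ ℤ`), regularity (`s₁ ι ≠ s₂ ι`) and
purity; the adjoint identity only through the shadow and the dihedral vacuity.
-/

set_option linter.dupNamespace false

noncomputable section

open scoped ComplexConjugate Classical
open NumberField Filter
open Literature.NumberTheory.Automorphic

namespace Summit.Langlands.Langlands.Theorems

open RegularTwistFromHalfIntegral

/-! ## The composition -/

/-- **`HalfIntegralTwistCM → RegularTwistCM` from the adjoint archimedean shadow and the descent
infinity type** (the r3 skeleton `RegularTwistCM_of_stubs` with stubs 1b/3/5 the landed theorems and the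
parity supplied by Clozel purity). For `K` CM, `π` regular algebraic cuspidal on `GL₃`, `σ₀` cuspidal on
`GL₂`, `ν` on `GL₁` with `t_π = d · Ad(t_{σ₀})` a.e.: `σ₀` is non-dihedral (`stub_dihedralVacuity`); write its
parameter as paired exponents `{s₁ ι, s₂ ι}` (descent infinity type); the shadow gives
`P_π(ι) = {s₁ - s₂ + q, q, s₂ - s₁ + q}` (`{q ι}` the parameter of `ν`), so `s₁ - s₂, q ∈ ℤ`
(C-algebraicity of `π`), `s₁ ≠ s₂` (regularity) and `(s₁ - s₂)(ι) + (s₁ - s₂)(ῑ)` even (purity of `π`);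
the central character of `σ₀` is a `GL(1)` datum with parameter `{s₁ + s₂}` (`stub_centralCharacterDatum`);
`HalfIntegralTwistCM` returns `χ` with parameter `{p ι}`, `p + s₁ ∈ ½ + ℤ`; and `σ = σ₀ ⊗ χ`
(`stub_twistRealisation`) carries the explicit regular algebraic infinity type
`{(s₁ + p)(ι), (s₁ + p)(ῑ)), ((s₂ + p)(ι), (s₂ + p)(ῑ))}`. [cite: Clozel1990, Lemme 4.9]
[cite: GelbartJacquet1978, Thm. (9.3)] -/
theorem RegularTwistFromHalfIntegral_of_inputs
    (hA : ∀ (K : Type) [Field K] [NumberField K]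
      (h1 : isCompact_glFiniteIntegralLevel 1 K) (hcpt₂ : isCompact_glFiniteIntegralLevel 2 K)
      (hcpt : isCompact_glFiniteIntegralLevel 3 K)
      (π : CuspidalAutomorphicRepData 3 K hcpt) (σ₀ : CuspidalAutomorphicRepData 2 K hcpt₂)
      (ν : CuspidalAutomorphicRepData 1 K h1),
      (∀ (L : Type) [Field L] [NumberField L] [Algebra K L], Module.finrank K L = 2 →
        ¬ IsQuadraticSelfTwistAE L σ₀.1) →
      (∀ᶠ v in cofinite, ∀ α β : Multiset ℂ, π.1.HasSatakeParamAt v α →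
        σ₀.1.HasSatakeParamAt v β → ∃ d : ℂ, ν.1.HasSatakeParamAt v {d} ∧
          α = (((β ×ˢ β).map (fun r : ℂ × ℂ => r.1 * r.2⁻¹)).erase 1).map (fun e => d * e)) →
      ∀ (χπ χσ χν : (K →+* ℂ) → Multiset ℂ),
        π.1.HasArchParameter χπ → σ₀.1.HasArchParameter χσ → ν.1.HasArchParameter χν →
        ∀ (ι : K →+* ℂ) (x y q : ℂ), χσ ι = {x, y} → χν ι = {q} →
          χπ ι = {x - y + q, q, y - x + q})
    (hD : ∀ (K : Type) [Field K] [NumberField K] (hcpt₂ : isCompact_glFiniteIntegralLevel 2 K)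
      (σ₀ : CuspidalAutomorphicRepData 2 K hcpt₂), σ₀.1.exists_hasInfinityType) :
    Summit.Langlands.Langlands.Theses.IrreducibilityBySelfDuality.RegularTwistFromHalfIntegral := by
  intro hH K _ _ hCM h1 hcpt₂ hcpt π σ₀ ν hRA hAd
  classical
  haveI : NeZero (2 : ℕ) := ⟨by norm_num⟩
  -- Step 0 (proved stub 1b): `σ₀` is not an a.e. quadratic self-twist
  have hnd : ∀ (L : Type) [Field L] [NumberField L] [Algebra K L], Module.finrank K L = 2 →
      ¬ IsQuadraticSelfTwistAE L σ₀.1 :=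
    fun L _ _ _ hL hst => RegularTwistCM.stub_dihedralVacuity K h1 hcpt₂ hcpt π σ₀ ν L hL hst hAd
  -- Step 1 (named fact, stub 2): paired exponent functions of `σ₀`
  obtain ⟨T₀, hT₀⟩ := hD K hcpt₂ σ₀
  obtain ⟨s₁, s₂, hσ, hpair⟩ := exists_paired_exponents_of_hasInfinityType hT₀
  -- Step 2 (tree): the archimedean parameter `{q ι}` of the `GL(1)` datum `ν`
  obtain ⟨χν, hχν⟩ := ν.1.exists_hasArchParameter_glOne
  have hq : ∃ q : (K →+* ℂ) → ℂ, ∀ ι, χν ι = {q ι} := by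
    have h1c : ∀ ι, ∃ a, χν ι = {a} := fun ι =>
      Multiset.card_eq_one.mp (AutomorphicRepData.card_eq_of_hasArchParameter hχν ι)
    choose q hq using h1c
    exact ⟨q, hq⟩
  obtain ⟨q, hq⟩ := hq
  -- Step 3: the regular algebraic infinity type of `π`
  obtain ⟨T, ⟨hTwf, hTarch⟩, hTC, hTreg⟩ := hRA
  -- Step 4 (stub 1a): the adjoint shadow at every embedding
  have hsh : ∀ ι, (T ι).map ArchWeight.a = {s₁ ι - s₂ ι + q ι, q ι, s₂ ι - s₁ ι + q ι} :=
    fun ι => hA K h1 hcpt₂ hcpt π σ₀ ν hnd hAd _ _ _ hTarch hσ hχν ι (s₁ ι) (s₂ ι) (q ι) rfl (hq ι)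
  -- Step 5: integrality from C-algebraicity of `π` (`n = 3`: exponents in `1 + ℤ = ℤ`)
  have hint : ∀ ι, ∀ z ∈ (T ι).map ArchWeight.a, ∃ k : ℤ, z = k := by
    intro ι z hz
    obtain ⟨w, hw, rfl⟩ := Multiset.mem_map.mp hz
    obtain ⟨k, l, hk, -⟩ := hTC ι w hw
    exact ⟨k + 1, by rw [hk]; push_cast; ring⟩
  have hqZ : ∀ ι, ∃ k : ℤ, q ι = k := fun ι => hint ι (q ι) (by rw [hsh ι]; simp)
  have haZ : ∀ ι, ∃ k : ℤ, s₁ ι - s₂ ι = k := by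
    intro ι
    obtain ⟨k₁, hk₁⟩ := hint ι (s₁ ι - s₂ ι + q ι) (by rw [hsh ι]; simp)
    obtain ⟨k₂, hk₂⟩ := hqZ ι
    exact ⟨k₁ - k₂, by push_cast; linear_combination hk₁ - hk₂⟩
  -- Step 6: regularity of `π` forces `s₁ ι ≠ s₂ ι`
  have ha0 : ∀ ι, s₁ ι - s₂ ι ≠ 0 := by
    intro ι h0
    have hnd := hTreg ι
    rw [hsh ι, Multiset.insert_eq_cons, Multiset.nodup_cons] at hnd
    apply hnd.1
    rw [h0, zero_add]
    simp
  -- Step 7 (Clozel purity, proved in tree): `{a at ῑ} = {w - a : a at ι}` for the C-algebraic `π`, and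
  -- the parity of `(s₁-s₂)(ι) + (s₁-s₂)(ῑ)` from the adjoint shape
  obtain ⟨w, hw⟩ := π.purity_of_isCAlgebraic ⟨hTwf, hTarch⟩ hTC
  have hpar : ∀ ι, ∃ m : ℤ, (s₁ ι - s₂ ι) +
      (s₁ (ComplexEmbedding.conjugate ι) - s₂ (ComplexEmbedding.conjugate ι)) = 2 * m := by
    intro ι
    have h := hw ι
    rw [hsh ι, hsh (ComplexEmbedding.conjugate ι)] at h
    exact parity_of_purity3 (haZ ι) (ha0 (ComplexEmbedding.conjugate ι)) h
  -- Step 8 (proved stub 3): the central character of `σ₀` as a `GL(1)` datum with parameter `{s₁ ι + s₂ ι}`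
  obtain ⟨ω, hω⟩ := RegularTwistCM.stub_centralCharacterDatum 2 K h1 hcpt₂ σ₀ _ hσ
  have hω' : ω.1.HasArchParameter (fun ι => {s₁ ι + s₂ ι}) := by
    have e : (fun ι : K →+* ℂ => ({(({s₁ ι, s₂ ι} : Multiset ℂ)).sum} : Multiset ℂ)) =
        fun ι => {s₁ ι + s₂ ι} := by
      funext ι
      simp
    rw [← e]
    exact hω
  -- Step 9 (the antecedent, route item HalfIntegralTwistCM): the half-integral twisting datum `χ`
  obtain ⟨χ, p, hχ, hp⟩ := hH K hCM h1 s₁ s₂ haZ (fun ι => (hpair ι).1) hpar ⟨ω, hω'⟩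
  -- Step 10 (proved stub 5): realise `σ = σ₀ ⊗ χ`
  obtain ⟨σ, hσarch, hσsat⟩ := RegularTwistCM.stub_twistRealisation 2 K h1 hcpt₂ σ₀ χ _ p hσ hχ
  refine ⟨σ, χ, ?_, hσsat⟩
  -- Step 11: the regular algebraic certificate of `σ` (explicit well-formed infinity type)
  choose mp hmp using hp
  choose ma hma using haZ
  have hw₁ : ∀ ι, ∃ m : ℤ, (s₁ ι + p ι) -
      (s₁ (ComplexEmbedding.conjugate ι) + p (ComplexEmbedding.conjugate ι)) = m := fun ι =>
    ⟨mp ι - mp (ComplexEmbedding.conjugate ι), by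
      push_cast; linear_combination hmp ι - hmp (ComplexEmbedding.conjugate ι)⟩
  have hw₂ : ∀ ι, ∃ m : ℤ, (s₂ ι + p ι) -
      (s₂ (ComplexEmbedding.conjugate ι) + p (ComplexEmbedding.conjugate ι)) = m := fun ι =>
    ⟨mp ι - mp (ComplexEmbedding.conjugate ι) - ma ι + ma (ComplexEmbedding.conjugate ι), by
      push_cast
      linear_combination hmp ι - hmp (ComplexEmbedding.conjugate ι) - hma ι +
        hma (ComplexEmbedding.conjugate ι)⟩
  let Tσ : InfinityType K 2 := fun ι =>
    {⟨s₁ ι + p ι, s₁ (ComplexEmbedding.conjugate ι) + p (ComplexEmbedding.conjugate ι), hw₁ ι⟩,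
     ⟨s₂ ι + p ι, s₂ (ComplexEmbedding.conjugate ι) + p (ComplexEmbedding.conjugate ι), hw₂ ι⟩}
  have hTa : ∀ ι, (Tσ ι).map ArchWeight.a = {s₁ ι + p ι, s₂ ι + p ι} := fun ι => by simp [Tσ]
  refine ⟨Tσ, ⟨⟨fun ι => by simp [Tσ], fun ι => ?_⟩, ?_⟩, fun ι w hw => ?_, fun ι => ?_⟩
  · -- conj-swap compatibility
    have e : ComplexEmbedding.conjugate (ComplexEmbedding.conjugate ι) = ι := star_star ι
    simp only [Tσ, Multiset.insert_eq_cons, Multiset.map_cons, Multiset.map_singleton]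
    congr 1
    · ext <;> simp [ArchWeight.swap, e]
    · congr 1
      ext <;> simp [ArchWeight.swap, e]
  · -- the archimedean parameter of `σ`
    have e : (fun ι : K →+* ℂ => (Tσ ι).map ArchWeight.a) =
        fun ι => (({s₁ ι, s₂ ι} : Multiset ℂ)).map (· + p ι) := by
      funext ι
      rw [hTa ι]
      simp
    rw [e]
    exact hσarch
  · -- C-algebraic: all exponents in `1/2 + ℤ`
    simp only [Tσ, Multiset.insert_eq_cons, Multiset.mem_cons, Multiset.mem_singleton] at hw
    rcases hw with rfl | rfl
    · refine ⟨mp ι, mp (ComplexEmbedding.conjugate ι), ?_, ?_⟩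
      · show s₁ ι + p ι = _
        push_cast
        linear_combination hmp ι
      · show s₁ (ComplexEmbedding.conjugate ι) + p (ComplexEmbedding.conjugate ι) = _
        push_cast
        linear_combination hmp (ComplexEmbedding.conjugate ι)
    · refine ⟨mp ι - ma ι, mp (ComplexEmbedding.conjugate ι) - ma (ComplexEmbedding.conjugate ι), ?_, ?_⟩
      · show s₂ ι + p ι = _
        push_cast
        linear_combination hmp ι - hma ι
      · show s₂ (ComplexEmbedding.conjugate ι) + p (ComplexEmbedding.conjugate ι) = _
        push_cast
        linear_combination hmp (ComplexEmbedding.conjugate ι) - hma (ComplexEmbedding.conjugate ι)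
  · -- regular
    rw [hTa ι, Multiset.insert_eq_cons, Multiset.nodup_cons]
    refine ⟨?_, Multiset.nodup_singleton _⟩
    rw [Multiset.mem_singleton]
    intro h
    exact ha0 ι (by linear_combination h)

/-- **`RegularTwistFromHalfIntegral` modulo the archimedean named facts** (CONDITIONAL result): the
route decl `HalfIntegralTwistCM → RegularTwistCM` follows from Gelbart–Jacquet 1978 Thm (9.3) with its
archimedean clause (`GelbartJacquet_adjoint_lift_archimedean`), the Borel–Jacquet dictionary
`hasSatakeParamAt_iff_L2` and Jacquet–Shalika's strong multiplicity one
`strong_multiplicity_one_gl_sphericalLevel 3 K` (the two `L²` leaves of archimedean SMO in the tree),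
and Clozel's existence of an infinity type for cuspidal `GL₂` data (`exists_hasInfinityType`; the
integral pairing). [cite: GelbartJacquet1978, Thm. (9.3)] [cite: JacquetShalikaAJM1981II, Thm. 4.4]
[cite: Clozel1990, §3.3 and Lemme 4.9] -/
theorem RegularTwistFromHalfIntegral_of
    (hGJ : GelbartJacquet_adjoint_lift_archimedean)
    (hL2 : ∀ (K : Type) [Field K] [NumberField K] (hcpt : isCompact_glFiniteIntegralLevel 3 K)
      (μ : MeasureTheory.Measure (AdelicGroupData.gl 3 K).automorphicQuotient)
      [(AdelicGroupData.gl 3 K).IsAutomorphicMeasure μ], hasSatakeParamAt_iff_L2 hcpt μ)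
    (hsmo : ∀ (K : Type) [Field K] [NumberField K], strong_multiplicity_one_gl_sphericalLevel 3 K)
    (hIT : ∀ (K : Type) [Field K] [NumberField K] (hcpt₂ : isCompact_glFiniteIntegralLevel 2 K)
      (σ₀ : CuspidalAutomorphicRepData 2 K hcpt₂), σ₀.1.exists_hasInfinityType) :
    Summit.Langlands.Langlands.Theses.IrreducibilityBySelfDuality.RegularTwistFromHalfIntegral :=
  RegularTwistFromHalfIntegral_of_inputs (adjointArchShadowNonDihedral_of_GJ hGJ hL2 hsmo) hIT

end Summit.Langlands.Langlands.Theorems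

end
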